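import Summits.QuantumFields.YangMills.Theorems.TunedSequenceExists.Negative.Freezing
import Summits.QuantumFields.YangMills.Theorems.TunedSequenceExists.Negative.AtZeroFalse

/-!
# `TunedSequenceExists` — negative lemma: the "free divergence" strengthening is false

Crux `Summit.QuantumFields.YangMills.Theses.ParabolicTrajectory.TunedSequenceExists` (item
stmt-QuantumFields-10524; cdisprove gen 2, importable extract of the crux workfile
`Summits/QuantumFields/YangMills/Cruxes/TunedSequenceExists/Disproof.lean`). From the freezing
theorem `Negative.Freezing.latticeConnectedCorr_curvature_tendsto_zero`:

* `exists_ceiling` — for all `(m, L)` there is `b(m, L)` beyond which the rescaled correlator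
  `(M^m)^8 ⟨P ; τ_{M^m} P⟩_{β, 2L+1}` is `< 1/(m+1)`;
* `eventually_beta_lt_ceiling` — every tuned witness has `β_k < b(n_k, L_k)` eventually;
* `window_dominating_false`, `tunedSequenceExists_dominating_false` — the strengthening of the
  crux in which the couplings may be required to dominate an arbitrary function of the lattice
  data `(n_k, L_k)` is FALSE (every `G`, `r`, `M ≥ 2`): the divergence `β_k → ∞` demanded by the
  crux is a TUNED one, capped by the lattice data (conjecturally `β_k ≍ log M^{n_k}`).
-/

noncomputable section

open Filter Topology MeasureTheory
open Literature.MathematicalPhysics.QuantumFieldTheory Literature.MathematicalPhysics.QuantumLattice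
open Summit.QuantumFields.YangMills.Theorems.TunedSequenceExists.Negative.Freezing
  (latticeConnectedCorr_curvature_tendsto_zero)

open Summit.QuantumFields.YangMills.Theorems.TunedSequenceExists.Negative.AtZeroFalse
  (tendsto_pow_of_shape tendsto_exponent_of_shape eventually_sep_le_L)

namespace Summit.QuantumFields.YangMills.Theorems.TunedSequenceExists.Negative.DominatingFalse

section Ceiling

variable {G : Type} [Group G] [TopologicalSpace G] [IsTopologicalGroup G] [CompactSpace G]
  [MeasurableSpace G] [BorelSpace G]

/-- **Coupling ceiling.** For all `(m, L)` there is `b(m, L)` beyond which the rescaled correlator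
at separation `M^m` on the torus of side `2L+1` is below `1/(m+1)`. -/
theorem exists_ceiling (r : LatticeRep G) (M : ℕ) :
    ∃ b : ℕ → ℕ → ℝ, ∀ (m L : ℕ) (β : ℝ), b m L ≤ β →
      |((M : ℝ) ^ m) ^ 8 *
          latticeConnectedCorr r.ρ β (2 * L + 1) r.curvature.F r.curvature.F (M ^ m)| <
        1 / ((m : ℝ) + 1) := by
  have h : ∀ m L : ℕ, ∃ b : ℝ, ∀ β : ℝ, b ≤ β →
      |((M : ℝ) ^ m) ^ 8 *
          latticeConnectedCorr r.ρ β (2 * L + 1) r.curvature.F r.curvature.F (M ^ m)| <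
        1 / ((m : ℝ) + 1) := fun m L => by
    have ht := (latticeConnectedCorr_curvature_tendsto_zero r (2 * L + 1) (M ^ m)).const_mul
      (((M : ℝ) ^ m) ^ 8)
    rw [mul_zero] at ht
    have ht0 : Tendsto (fun β : ℝ => |((M : ℝ) ^ m) ^ 8 *
        latticeConnectedCorr r.ρ β (2 * L + 1) r.curvature.F r.curvature.F (M ^ m)|)
        atTop (𝓝 0) := by
      simpa using ht.abs
    have hε : (0 : ℝ) < 1 / ((m : ℝ) + 1) := by positivity
    exact eventually_atTop.1 (ht0.eventually (gt_mem_nhds hε))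
  choose b hb using h
  exact ⟨b, hb⟩

/-- **Every tuned witness stays below the ceiling eventually.** -/
theorem eventually_beta_lt_ceiling (r : LatticeRep G) {M : ℕ} (hM : 2 ≤ M) :
    ∃ b : ℕ → ℕ → ℝ, ∀ (sch : SpeciesScheme (YMSpecies G)) (n : ℕ → ℕ) (θ : ℝ), 0 < θ →
      (∀ k, sch.a k = ((M : ℝ) ^ n k)⁻¹) →
      Tendsto (fun k => ((M : ℝ) ^ n k) ^ 8 *
          latticeConnectedCorr r.ρ (sch.β k) (sch.side k) r.curvature.F r.curvature.F
            (M ^ n k)) atTop (𝓝 θ) →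
      ∀ᶠ k in atTop, sch.β k < b (n k) (sch.L k) := by
  obtain ⟨b, hb⟩ := exists_ceiling r M
  refine ⟨b, fun sch n θ hθ hshape hlim => ?_⟩
  have hn := tendsto_exponent_of_shape hM sch hshape
  -- eventually the tuned correlator exceeds θ/2 …
  have hθ2 : θ / 2 < θ := by linarith
  have hev1 : ∀ᶠ k in atTop, θ / 2 < ((M : ℝ) ^ n k) ^ 8 *
      latticeConnectedCorr r.ρ (sch.β k) (sch.side k) r.curvature.F r.curvature.F (M ^ n k) :=
    hlim.eventually (lt_mem_nhds hθ2)
  -- … while the ceiling bound 1/(n_k+1) drops below θ/2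
  have hev2 : ∀ᶠ k in atTop, 1 / ((n k : ℝ) + 1) < θ / 2 := by
    have h0 : Tendsto (fun k => 1 / ((n k : ℝ) + 1)) atTop (𝓝 0) :=
      tendsto_one_div_add_atTop_nhds_zero_nat.comp hn
    exact h0.eventually (gt_mem_nhds (half_pos hθ))
  by_contra hcon
  obtain ⟨k, hk, hk1, hk2⟩ := ((not_eventually.1 hcon).and_eventually (hev1.and hev2)).exists
  have hβ : b (n k) (sch.L k) ≤ sch.β k := not_lt.1 hk
  have hc := hb (n k) (sch.L k) (sch.β k) hβ
  have hc' : ((M : ℝ) ^ n k) ^ 8 *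
      latticeConnectedCorr r.ρ (sch.β k) (sch.side k) r.curvature.F r.curvature.F (M ^ n k) <
        1 / ((n k : ℝ) + 1) := lt_of_le_of_lt (le_abs_self _) hc
  linarith

/-- **The "free divergence" strengthening of the crux body is false** for every `G`, `r`,
`M ≥ 2`: there is a growth requirement `β_k ≥ f(n_k, L_k)` incompatible with tuning. -/
theorem window_dominating_false (r : LatticeRep G) {M : ℕ} (hM : 2 ≤ M) :
    ¬ (∀ f : ℕ → ℕ → ℝ, ∃ θ₀ : ℝ, 0 < θ₀ ∧ ∀ θ : ℝ, 0 < θ → θ < θ₀ →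
        ∃ (sch : SpeciesScheme (YMSpecies G)) (n : ℕ → ℕ),
          (∀ k, sch.a k = ((M : ℝ) ^ n k)⁻¹) ∧ (∀ k, f (n k) (sch.L k) ≤ sch.β k) ∧
          Tendsto (fun k => ((M : ℝ) ^ n k) ^ 8 *
              latticeConnectedCorr r.ρ (sch.β k) (sch.side k) r.curvature.F r.curvature.F
                (M ^ n k)) atTop (𝓝 θ)) := by
  intro h
  obtain ⟨b, hb⟩ := eventually_beta_lt_ceiling r hM
  obtain ⟨θ₀, hθ₀, h⟩ := h b
  obtain ⟨sch, n, hshape, hdom, hlim⟩ := h (θ₀ / 2) (by positivity) (by linarith)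
  obtain ⟨k, hk⟩ := (hb sch n (θ₀ / 2) (by positivity) hshape hlim).exists
  exact absurd (hdom k) (not_le.2 hk)

end Ceiling

/-- **`TunedSequenceExists` with "`β_k → ∞`" strengthened to "`β_k` dominates any prescribed
function of the lattice data" is false**, relative to any inhabitant of `IsCompactSimpleLieGroup`
(e.g. `SU(2)` via the tree's named fact `isSimpleCompactGroup_specialUnitaryGroup`). -/
theorem tunedSequenceExists_dominating_false {H : Type} [Group H] [TopologicalSpace H]
    [IsTopologicalGroup H] [CompactSpace H] (hH : IsCompactSimpleLieGroup H) :
    ¬ (∀ (G : Type) [Group G] [TopologicalSpace G] [IsTopologicalGroup G] [CompactSpace G],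
        IsCompactSimpleLieGroup G → letI : MeasurableSpace G := borel G
        haveI : BorelSpace G := ⟨rfl⟩
        ∀ (r : LatticeRep G) (M : ℕ), 2 ≤ M → ∀ f : ℕ → ℕ → ℝ, ∃ θ₀ : ℝ, 0 < θ₀ ∧
          ∀ θ : ℝ, 0 < θ → θ < θ₀ →
            ∃ (sch : SpeciesScheme (YMSpecies G)) (n : ℕ → ℕ),
              (∀ k, sch.a k = ((M : ℝ) ^ n k)⁻¹) ∧ (∀ k, f (n k) (sch.L k) ≤ sch.β k) ∧
              Tendsto (fun k => ((M : ℝ) ^ n k) ^ 8 *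
                  latticeConnectedCorr r.ρ (sch.β k) (sch.side k) r.curvature.F r.curvature.F
                    (M ^ n k)) atTop (𝓝 θ)) := by
  intro h
  obtain ⟨r⟩ := hH.2
  letI : MeasurableSpace H := borel H
  haveI : BorelSpace H := ⟨rfl⟩
  exact window_dominating_false r le_rfl (h H hH r 2 le_rfl)

end Summit.QuantumFields.YangMills.Theorems.TunedSequenceExists.Negative.DominatingFalse

end
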